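import Literature.Probability.RandomPlanarGeometry.ObliqueRBMWedgeKernel
import Mathlib.Analysis.Complex.HasPrimitives
import Mathlib.MeasureTheory.Integral.IntegralEqImproper
import Mathlib.Analysis.SpecialFunctions.Integrability.Basic
import Mathlib.Analysis.SpecialFunctions.ImproperIntegrals
import HarnessLib

/-!
# The half-plane primitive `Φ` of the oblique test kernel and its boundary behaviour

Layer of the proof of
`Literature.Probability.RandomPlanarGeometry.LawlerSchrammWerner2001_orbm_uniformHitting`
(`ObliqueRBMWedge.lean`). For the kernel `Φ' = TestIntervals.phiKernel` of
`ObliqueRBMWedgeKernel.lean` we construct the primitive `Φ` on the open upper half-plane as a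
wedge integral (`Complex.wedgeIntegral`, Mathlib's Morera/primitive machinery on discs, glued
along the discs `B(iR, R) ↑ ℍ`), and establish:

* `hasDerivAt_phi` — `Φ' ` is the complex derivative of `Φ` on `ℍ`;
* vertical / horizontal difference formulas (`phi_vert`, `phi_horiz`);
* quantitative limits: at `∞` (`norm_phi_sub_phiInf_le`, rate `33/‖w‖` from the decay
  `‖Φ'‖ ≤ 12/‖w‖²`), at the vertices `0` and `1` (`norm_phi_sub_phiZero_le`,
  `norm_phi_sub_phiOne_le`, rate `‖w‖^{2/3}` from `‖Φ'‖ ≲ ‖w‖^{-1/3}`);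
* local holomorphic extension across regular real points (`exists_primitive_near`).

## References

* L. V. Ahlfors, *Complex Analysis* (1979), Ch. 4 §§1–2 (primitives, Cauchy on rectangles);
  J. Dubédat, Ann. IHP 40 (2004), §4. [Dubedat2004]
-/

noncomputable section

open Set Filter Topology Complex MeasureTheory intervalIntegral Metric
open scoped Real Interval
open UpperHalfPlane (upperHalfPlaneSet isOpen_upperHalfPlaneSet)

namespace Literature.Probability.RandomPlanarGeometry

namespace TestIntervals

variable (D : TestIntervals)

/-! ### Continuity of the kernel along horizontal and vertical lines in `ℍ` -/

/-- Auxiliary statement (`im_pos_mem_kernelDomain`). [folklore] -/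
theorem mem_kernelDomain_of_im_pos {w : ℂ} (hw : 0 < w.im) : w ∈ D.kernelDomain :=
  D.upperHalfPlaneSet_subset_kernelDomain hw

/-- Auxiliary statement (`continuousAt_phiKernel`). [folklore] -/
theorem continuousAt_phiKernel {w : ℂ} (hw : w ∈ D.kernelDomain) : ContinuousAt D.phiKernel w :=
  D.continuousOn_phiKernel.continuousAt (D.isOpen_kernelDomain.mem_nhds hw)

/-- The kernel is continuous along a horizontal line at positive height. [folklore] -/
theorem continuous_phiKernel_horiz {h : ℝ} (hh : 0 < h) : Continuous fun t : ℝ ↦ D.phiKernel (t + h * I) := by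
  refine continuous_iff_continuousAt.2 fun t ↦ ?_
  have hmem : ((t : ℂ) + h * I) ∈ D.kernelDomain := D.mem_kernelDomain_of_im_pos (by simp [hh])
  exact ContinuousAt.comp (f := fun t : ℝ ↦ (t : ℂ) + h * I) (D.continuousAt_phiKernel hmem)
    (by fun_prop : Continuous fun t : ℝ ↦ (t : ℂ) + h * I).continuousAt

/-- The kernel is continuous along a vertical segment in `ℍ`. [folklore] -/
theorem continuousOn_phiKernel_vert (x : ℝ) {a b : ℝ} (ha : 0 < a) (hb : 0 < b) :
    ContinuousOn (fun y : ℝ ↦ D.phiKernel (x + y * I)) (uIcc a b) := by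
  intro y hy
  have hy0 : 0 < y := by
    rcases le_total a b with h | h
    · rw [uIcc_of_le h] at hy; exact ha.trans_le hy.1
    · rw [uIcc_of_ge h] at hy; exact hb.trans_le hy.1
  have hmem : ((x : ℂ) + y * I) ∈ D.kernelDomain := D.mem_kernelDomain_of_im_pos (by simp [hy0])
  exact (ContinuousAt.comp (f := fun y : ℝ ↦ (x : ℂ) + y * I) (D.continuousAt_phiKernel hmem)
    (by fun_prop : Continuous fun y : ℝ ↦ (x : ℂ) + y * I).continuousAt).continuousWithinAt

/-- Auxiliary statement (`intervalIntegrable_phiKernel_vert`). [folklore] -/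
theorem intervalIntegrable_phiKernel_vert (x : ℝ) {a b : ℝ} (ha : 0 < a) (hb : 0 < b) :
    IntervalIntegrable (fun y : ℝ ↦ D.phiKernel (x + y * I)) volume a b :=
  (D.continuousOn_phiKernel_vert x ha hb).intervalIntegrable

/-- Auxiliary statement (`intervalIntegrable_phiKernel_horiz`). [folklore] -/
theorem intervalIntegrable_phiKernel_horiz {h : ℝ} (hh : 0 < h) (a b : ℝ) :
    IntervalIntegrable (fun t : ℝ ↦ D.phiKernel (t + h * I)) volume a b :=
  (D.continuous_phiKernel_horiz hh).intervalIntegrable a b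

/-! ### The primitive -/

/-- **The primitive** `Φ(w) = ∫₀^{re w} Φ'(x + i) dx + i ∫₁^{im w} Φ'(re w + iy) dy`
(the wedge integral from the base point `i`). [folklore] -/
def phi (w : ℂ) : ℂ := Complex.wedgeIntegral I w D.phiKernel

/-- Auxiliary statement (`phi_def`). [folklore] -/
theorem phi_def (w : ℂ) : D.phi w = (∫ x in (0:ℝ)..w.re, D.phiKernel (x + (1:ℝ) * I))
    + I * ∫ y in (1:ℝ)..w.im, D.phiKernel (w.re + y * I) := by
  simp [phi, Complex.wedgeIntegral]

/-- Auxiliary statement (`isConservativeOn_phiKernel`). [folklore] -/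
theorem isConservativeOn_phiKernel : Complex.IsConservativeOn D.phiKernel upperHalfPlaneSet :=
  D.differentiableOn_phiKernel_upperHalfPlaneSet.isConservativeOn

/-- **Change of base point**: `Φ(w) = wedge_{iR}(w) + i ∫₁^R Φ'(iy) dy` for `w ∈ ℍ`, `R > 0`
(Cauchy's theorem on the rectangle `[0, re w] × [1, R]`). [folklore] -/
theorem phi_eq_wedgeIntegral {R : ℝ} (hR : 0 < R) {w : ℂ} (hw : 0 < w.im) :
    D.phi w = Complex.wedgeIntegral (R * I) w D.phiKernel + I * ∫ y in (1:ℝ)..R, D.phiKernel ((0:ℝ) + y * I) := by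
  have hrect : Rectangle I (w.re + R * I) ⊆ upperHalfPlaneSet := by
    intro z hz
    rw [Rectangle, mem_reProdIm] at hz
    have h2 := hz.2
    simp only [I_im, add_im, ofReal_im, mul_im, ofReal_re, I_re, mul_zero, zero_add, mul_one, add_zero] at h2
    show 0 < z.im
    rcases le_total 1 R with h | h
    · rw [uIcc_of_le h] at h2; linarith [h2.1]
    · rw [uIcc_of_ge h] at h2; linarith [h2.1]
  have hc := D.isConservativeOn_phiKernel I (w.re + R * I) hrect
  simp only [Complex.wedgeIntegral, I_re, I_im, add_re, ofReal_re, mul_re, I_re, mul_zero, ofReal_im,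
    I_im, mul_one, sub_self, add_zero, add_im, mul_im, zero_add, smul_eq_mul, ofReal_one, one_mul,
    ofReal_zero] at hc ⊢
  rw [phi_def]
  simp only [ofReal_one, one_mul]
  rw [intervalIntegral.integral_symm 0 w.re, intervalIntegral.integral_symm 1 R] at hc
  have hsub := intervalIntegral.integral_interval_sub_left (D.intervalIntegrable_phiKernel_vert w.re one_pos hw)
    (D.intervalIntegrable_phiKernel_vert w.re one_pos hR)
  linear_combination hc + I * hsub

/-- Auxiliary statement (`mem_ball_mul_I`). [folklore] -/
theorem mem_ball_mul_I {z : ℂ} (hz : 0 < z.im) : z ∈ ball ((((‖z‖ ^ 2 / z.im + 1 : ℝ)) : ℂ) * I) (‖z‖ ^ 2 / z.im + 1) := by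
  set R : ℝ := ‖z‖ ^ 2 / z.im + 1 with hR
  have hRpos : 0 < R := by positivity
  rw [mem_ball, dist_eq_norm]
  have hsq : ‖z - (R : ℂ) * I‖ ^ 2 < R ^ 2 := by
    rw [← Complex.normSq_eq_norm_sq (z := z - R * I)]
    have : Complex.normSq (z - (R : ℂ) * I) = z.re * z.re + (z.im - R) * (z.im - R) := by
      rw [Complex.normSq_apply]; simp
    rw [this]
    have hz2 : ‖z‖ ^ 2 = z.re * z.re + z.im * z.im := by
      rw [← Complex.normSq_eq_norm_sq, Complex.normSq_apply]
    have hRim : R * z.im = ‖z‖ ^ 2 + z.im := by rw [hR]; field_simp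
    nlinarith
  nlinarith [norm_nonneg (z - (R : ℂ) * I)]

/-- Auxiliary statement (`ball_mul_I_subset`). [folklore] -/
theorem ball_mul_I_subset (R : ℝ) : ball ((R : ℂ) * I) R ⊆ upperHalfPlaneSet := by
  intro w hw
  rw [mem_ball, dist_eq_norm] at hw
  have h := abs_im_le_norm (w - (R : ℂ) * I)
  simp only [sub_im, mul_im, ofReal_re, I_im, mul_one, ofReal_im, I_re, mul_zero, add_zero] at h
  show 0 < w.im
  have := h.trans_lt hw
  rw [abs_lt] at this
  linarith [this.1]

/-- **`Φ` is a primitive of `Φ'` on the upper half-plane.** [folklore] -/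
theorem hasDerivAt_phi {z : ℂ} (hz : 0 < z.im) : HasDerivAt D.phi (D.phiKernel z) z := by
  set R : ℝ := ‖z‖ ^ 2 / z.im + 1 with hR
  have hRpos : 0 < R := by positivity
  have hzball : z ∈ ball ((R : ℂ) * I) R := mem_ball_mul_I hz
  have hsub : ball ((R : ℂ) * I) R ⊆ upperHalfPlaneSet := ball_mul_I_subset R
  have hdiff : DifferentiableOn ℂ D.phiKernel (ball ((R : ℂ) * I) R) :=
    D.differentiableOn_phiKernel_upperHalfPlaneSet.mono hsub
  have hderiv : HasDerivAt (fun w ↦ Complex.wedgeIntegral ((R : ℂ) * I) w D.phiKernel) (D.phiKernel z) z :=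
    hdiff.isConservativeOn.hasDerivAt_wedgeIntegral hdiff.continuousOn hzball
  have hderiv' := hderiv.add_const (I * ∫ y in (1:ℝ)..R, D.phiKernel ((0:ℝ) + y * I))
  refine hderiv'.congr_of_eventuallyEq ?_
  filter_upwards [isOpen_upperHalfPlaneSet.mem_nhds hz] with w hw
  exact D.phi_eq_wedgeIntegral hRpos hw

/-- Auxiliary statement (`differentiableOn_phi`). [folklore] -/
theorem differentiableOn_phi : DifferentiableOn ℂ D.phi upperHalfPlaneSet :=
  fun _ hw ↦ (D.hasDerivAt_phi hw).differentiableAt.differentiableWithinAt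

/-- Auxiliary statement (`continuousOn_phi`). [folklore] -/
theorem continuousOn_phi : ContinuousOn D.phi upperHalfPlaneSet := D.differentiableOn_phi.continuousOn

/-- **Vertical differences**: `Φ(x + ih) − Φ(x + iy) = i ∫_y^h Φ'(x + is) ds`. [folklore] -/
theorem phi_vert (x : ℝ) {y h : ℝ} (hy : 0 < y) (hh : 0 < h) :
    D.phi (x + h * I) - D.phi (x + y * I) = I * ∫ s in y..h, D.phiKernel (x + s * I) := by
  rw [phi_def, phi_def]
  simp only [add_re, ofReal_re, mul_re, I_re, mul_zero, ofReal_im, I_im, mul_one, sub_self, add_zero,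
    add_im, mul_im, zero_add]
  have hsub := intervalIntegral.integral_interval_sub_left (D.intervalIntegrable_phiKernel_vert x one_pos hh)
    (D.intervalIntegrable_phiKernel_vert x one_pos hy)
  linear_combination I * hsub

/-- **Horizontal differences**: `Φ(x₂ + ih) − Φ(x₁ + ih) = ∫_{x₁}^{x₂} Φ'(t + ih) dt`. [folklore] -/
theorem phi_horiz (x₁ x₂ : ℝ) {h : ℝ} (hh : 0 < h) :
    D.phi (x₂ + h * I) - D.phi (x₁ + h * I) = ∫ t in x₁..x₂, D.phiKernel (t + h * I) := by
  rw [D.phi_eq_wedgeIntegral hh (by simp [hh] : 0 < ((x₂ : ℂ) + h * I).im),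
    D.phi_eq_wedgeIntegral hh (by simp [hh] : 0 < ((x₁ : ℂ) + h * I).im)]
  simp only [Complex.wedgeIntegral, mul_re, ofReal_re, I_re, mul_zero, ofReal_im, I_im, mul_one, sub_self,
    add_re, add_zero, mul_im, zero_add, add_im, intervalIntegral.integral_same, smul_zero]
  have hsub := intervalIntegral.integral_interval_sub_left (D.intervalIntegrable_phiKernel_horiz hh 0 x₂)
    (D.intervalIntegrable_phiKernel_horiz hh 0 x₁)
  linear_combination hsub

/-! ### The kernel along the imaginary direction; the limit at infinity -/

/-- The kernel is continuous along the vertical ray `{x + iy : y > 0}`. [folklore] -/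
theorem continuousOn_phiKernel_vert_Ioi (x : ℝ) : ContinuousOn (fun y : ℝ ↦ D.phiKernel (x + y * I)) (Ioi 0) := by
  intro y hy
  have hmem : ((x : ℂ) + y * I) ∈ D.kernelDomain := D.mem_kernelDomain_of_im_pos (by simpa using hy)
  exact (ContinuousAt.comp (f := fun y : ℝ ↦ (x : ℂ) + y * I) (D.continuousAt_phiKernel hmem)
    (by fun_prop : Continuous fun y : ℝ ↦ (x : ℂ) + y * I).continuousAt).continuousWithinAt

/-- Auxiliary statement (`normSq_ofReal_add_mul_I`). [folklore] -/
theorem normSq_ofReal_add_mul_I (x s : ℝ) : Complex.normSq ((x : ℂ) + s * I) = x * x + s * s := by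
  rw [Complex.normSq_apply]; simp

/-- Auxiliary statement (`le_norm_ofReal_add_mul_I`). [folklore] -/
theorem le_norm_ofReal_add_mul_I (x : ℝ) {s : ℝ} (hs : 0 ≤ s) : s ≤ ‖(x : ℂ) + s * I‖ := by
  have h := abs_im_le_norm ((x : ℂ) + s * I)
  simp only [add_im, ofReal_im, mul_im, ofReal_re, I_im, mul_one, I_re, mul_zero, add_zero, zero_add,
    abs_of_nonneg hs] at h
  exact h

/-- Auxiliary statement (`norm_le_norm_ofReal_add_mul_I`). [folklore] -/
theorem norm_le_norm_ofReal_add_mul_I {w : ℂ} {s : ℝ} (hw : 0 ≤ w.im) (hs : w.im ≤ s) :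
    ‖w‖ ≤ ‖(w.re : ℂ) + s * I‖ := by
  have h1 : ‖w‖ ^ 2 ≤ ‖(w.re : ℂ) + s * I‖ ^ 2 := by
    rw [← Complex.normSq_eq_norm_sq, ← Complex.normSq_eq_norm_sq, normSq_ofReal_add_mul_I, Complex.normSq_apply]
    nlinarith
  nlinarith [norm_nonneg w, norm_nonneg ((w.re : ℂ) + s * I)]

/-- **Integrability of the kernel on the imaginary ray `[1, ∞)`.** [folklore] -/
theorem integrableOn_phiKernel_imag_Ioi : IntegrableOn (fun y : ℝ ↦ D.phiKernel ((0:ℝ) + y * I)) (Ioi 1) := by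
  have hcont := D.continuousOn_phiKernel_vert_Ioi 0
  have h14 : IntegrableOn (fun y : ℝ ↦ D.phiKernel ((0:ℝ) + y * I)) (Ioc 1 4) :=
    ((hcont.mono (by intro y hy; exact lt_of_lt_of_le one_pos hy.1)).integrableOn_Icc (a := 1) (b := 4)).mono_set
      Ioc_subset_Icc_self
  have h4 : IntegrableOn (fun y : ℝ ↦ D.phiKernel ((0:ℝ) + y * I)) (Ioi 4) := by
    have hg : IntegrableOn (fun y : ℝ ↦ 12 * y ^ (-(2:ℝ))) (Ioi 4) :=
      ((integrableOn_Ioi_rpow_of_lt (by norm_num) (by norm_num)).const_mul 12)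
    refine hg.mono' ?_ ?_
    · exact (hcont.mono fun y hy ↦ lt_trans (by norm_num) (mem_Ioi.1 hy)).aestronglyMeasurable measurableSet_Ioi
    · refine (ae_restrict_iff' measurableSet_Ioi).2 (ae_of_all _ fun y hy ↦ ?_)
      have hy4 : 4 < y := hy
      have hnorm : ‖((0:ℝ) : ℂ) + y * I‖ = y := by
        simp [Complex.norm_real]; linarith
      have := D.norm_phiKernel_le (w := ((0:ℝ) : ℂ) + y * I) (by rw [hnorm]; exact hy4.le)
      rw [hnorm] at this
      refine this.trans (le_of_eq ?_)
      rw [Real.rpow_neg (by linarith), Real.rpow_two, div_eq_mul_inv]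
  have := h14.union h4
  rwa [Ioc_union_Ioi_eq_Ioi (by norm_num : (1:ℝ) ≤ 4)] at this

/-- **The value at infinity** `Φ(∞) = i ∫₁^∞ Φ'(iy) dy`. [folklore] -/
def phiInf : ℂ := I * ∫ y in Ioi (1:ℝ), D.phiKernel ((0:ℝ) + y * I)

/-- Auxiliary statement (`phi_imag`). [folklore] -/
theorem phi_imag (T : ℝ) : D.phi ((0:ℝ) + T * I) = I * ∫ y in (1:ℝ)..T, D.phiKernel ((0:ℝ) + y * I) := by
  rw [phi_def]
  simp

/-- **Rate at infinity along the imaginary axis**: `‖Φ(iT) − Φ(∞)‖ ≤ 12/T` for `T ≥ 4`. [folklore] -/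
theorem norm_phi_imag_sub_phiInf_le {T : ℝ} (hT : 4 ≤ T) : ‖D.phi ((0:ℝ) + T * I) - D.phiInf‖ ≤ 12 / T := by
  have hT0 : 0 < T := by linarith
  have hint := D.integrableOn_phiKernel_imag_Ioi
  have hsplit := intervalIntegral.integral_Ioi_sub_Ioi hint (by linarith : (1:ℝ) ≤ T)
  have hintT : IntegrableOn (fun y : ℝ ↦ D.phiKernel ((0:ℝ) + y * I)) (Ioi T) := hint.mono_set (Ioi_subset_Ioi (by linarith))
  rw [phi_imag, phiInf, ← mul_sub, ← hsplit, sub_sub_cancel_left, mul_neg, norm_neg, norm_mul, Complex.norm_I, one_mul]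
  have hg : IntegrableOn (fun y : ℝ ↦ 12 * y ^ (-(2:ℝ))) (Ioi T) :=
    ((integrableOn_Ioi_rpow_of_lt (by norm_num) hT0).const_mul 12)
  calc ‖∫ y in Ioi T, D.phiKernel ((0:ℝ) + y * I)‖ ≤ ∫ y in Ioi T, 12 * y ^ (-(2:ℝ)) := by
        refine norm_integral_le_of_norm_le hg ((ae_restrict_iff' measurableSet_Ioi).2 (ae_of_all _ fun y hy ↦ ?_))
        have hyT : T < y := hy
        have hnorm : ‖((0:ℝ) : ℂ) + y * I‖ = y := by
          simp [Complex.norm_real]; linarith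
        have := D.norm_phiKernel_le (w := ((0:ℝ) : ℂ) + y * I) (by rw [hnorm]; linarith)
        rw [hnorm] at this
        refine this.trans (le_of_eq ?_)
        rw [Real.rpow_neg (by linarith), Real.rpow_two, div_eq_mul_inv]
    _ = 12 / T := by
        rw [MeasureTheory.integral_const_mul, integral_Ioi_rpow_of_lt (by norm_num) hT0]
        norm_num
        rw [Real.rpow_neg_one]; field_simp

/-- **Rate at infinity**: `‖Φ(w) − Φ(∞)‖ ≤ 33/‖w‖` for `w ∈ ℍ`, `‖w‖ ≥ 4` (vertical move up to height
`2‖w‖`, horizontal move to the imaginary axis, tail of the ray integral). [folklore] -/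
theorem norm_phi_sub_phiInf_le {w : ℂ} (hw : 0 < w.im) (hw4 : 4 ≤ ‖w‖) : ‖D.phi w - D.phiInf‖ ≤ 33 / ‖w‖ := by
  have hwpos : 0 < ‖w‖ := by linarith
  set x := w.re with hx
  set y := w.im with hy
  set T := 2 * ‖w‖ with hT
  have hT0 : 0 < T := by positivity
  have hwxy : w = (x : ℂ) + y * I := by rw [hx, hy, re_add_im]
  have hy_le : y ≤ ‖w‖ := by
    have := abs_im_le_norm w; rwa [abs_of_pos hw] at this
  have hyT : y ≤ T := by linarith
  -- leg 1 (vertical)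
  have leg1 := D.phi_vert x hw hT0
  have hb1 : ‖∫ s in y..T, D.phiKernel (x + s * I)‖ ≤ 12 / ‖w‖ ^ 2 * |T - y| := by
    refine intervalIntegral.norm_integral_le_of_norm_le_const fun s hs ↦ ?_
    rw [uIoc_of_le hyT] at hs
    have hs0 : 0 < s := hw.trans_le hs.1.le
    have hws : ‖w‖ ≤ ‖(x : ℂ) + s * I‖ := by
      have := norm_le_norm_ofReal_add_mul_I hw.le hs.1.le; rwa [← hx] at this
    have h4s : 4 ≤ ‖(x : ℂ) + s * I‖ := hw4.trans hws
    calc ‖D.phiKernel (x + s * I)‖ ≤ 12 / ‖(x : ℂ) + s * I‖ ^ 2 := D.norm_phiKernel_le h4s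
      _ ≤ 12 / ‖w‖ ^ 2 := by
          apply div_le_div_of_nonneg_left (by norm_num) (by positivity)
          exact pow_le_pow_left₀ (norm_nonneg _) hws 2
  -- leg 2 (horizontal)
  have leg2 := D.phi_horiz 0 x hT0
  have hb2 : ‖∫ t in (0:ℝ)..x, D.phiKernel (t + T * I)‖ ≤ 12 / T ^ 2 * |x - 0| := by
    refine intervalIntegral.norm_integral_le_of_norm_le_const fun t _ ↦ ?_
    have hTt : T ≤ ‖(t : ℂ) + T * I‖ := le_norm_ofReal_add_mul_I t hT0.le
    have h4t : 4 ≤ ‖(t : ℂ) + T * I‖ := by linarith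
    calc ‖D.phiKernel (t + T * I)‖ ≤ 12 / ‖(t : ℂ) + T * I‖ ^ 2 := D.norm_phiKernel_le h4t
      _ ≤ 12 / T ^ 2 := by
          apply div_le_div_of_nonneg_left (by norm_num) (by positivity)
          exact pow_le_pow_left₀ hT0.le hTt 2
  -- leg 3 (tail)
  have hb3 := D.norm_phi_imag_sub_phiInf_le (T := T) (by linarith)
  have hx_le : |x - 0| ≤ ‖w‖ := by rw [sub_zero]; exact abs_re_le_norm w
  have hTy : |T - y| ≤ T := by rw [abs_of_nonneg (by linarith)]; linarith [hw.le]
  -- assemble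
  have hdecomp : D.phi w - D.phiInf = -(D.phi (x + T * I) - D.phi (x + y * I))
      + (D.phi (x + T * I) - D.phi ((0:ℝ) + T * I)) + (D.phi ((0:ℝ) + T * I) - D.phiInf) := by
    rw [hwxy]; ring
  rw [hdecomp]
  have e1 : ‖-(D.phi (x + T * I) - D.phi (x + y * I))‖ ≤ 24 / ‖w‖ := by
    rw [norm_neg, leg1, norm_mul, Complex.norm_I, one_mul]
    refine hb1.trans ?_
    calc 12 / ‖w‖ ^ 2 * |T - y| ≤ 12 / ‖w‖ ^ 2 * T := by gcongr
      _ = 24 / ‖w‖ := by rw [hT]; field_simp; ring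
  have e2 : ‖D.phi (x + T * I) - D.phi ((0:ℝ) + T * I)‖ ≤ 3 / ‖w‖ := by
    rw [leg2]
    refine hb2.trans ?_
    calc 12 / T ^ 2 * |x - 0| ≤ 12 / T ^ 2 * ‖w‖ := by gcongr
      _ = 3 / ‖w‖ := by rw [hT]; field_simp; ring
  have e3 : ‖D.phi ((0:ℝ) + T * I) - D.phiInf‖ ≤ 6 / ‖w‖ := by
    refine hb3.trans (le_of_eq ?_)
    rw [hT]; field_simp; ring
  calc _ ≤ ‖-(D.phi (x + T * I) - D.phi (x + y * I))‖ + ‖D.phi (x + T * I) - D.phi ((0:ℝ) + T * I)‖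
        + ‖D.phi ((0:ℝ) + T * I) - D.phiInf‖ := norm_add₃_le
    _ ≤ 24 / ‖w‖ + 3 / ‖w‖ + 6 / ‖w‖ := by gcongr
    _ = 33 / ‖w‖ := by ring

/-! ### Behaviour at a vertex: generic three-leg estimate -/

/-- Auxiliary statement (`two_rpow_two_thirds_le`). [folklore] -/
theorem two_rpow_two_thirds_le : (2:ℝ) ^ (2 / 3 : ℝ) ≤ 2 := by
  conv_rhs => rw [← Real.rpow_one 2]
  exact Real.rpow_le_rpow_of_exponent_le (by norm_num) (by norm_num)

/-- Auxiliary statement (`rpow_neg_third_le_two`). [folklore] -/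
theorem rpow_neg_third_le_two {t : ℝ} (ht : 1 / 2 ≤ t) : t ^ (-(1 / 3 : ℝ)) ≤ 2 := by
  have h1 : t ^ (-(1 / 3 : ℝ)) ≤ (1 / 2 : ℝ) ^ (-(1 / 3 : ℝ)) :=
    Real.rpow_le_rpow_of_nonpos (by norm_num) ht (by norm_num)
  refine h1.trans ?_
  rw [one_div, Real.inv_rpow (by norm_num), Real.rpow_neg (by norm_num), inv_inv]
  conv_rhs => rw [← Real.rpow_one 2]
  exact Real.rpow_le_rpow_of_exponent_le (by norm_num) (by norm_num)

/-- **Vertical leg near a vertex**: if `‖Φ'(x + is)‖ ≤ C s^{-1/3}` on `(y, h]` then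
`‖∫_y^h Φ'(x + is) ds‖ ≤ (3/2) C h^{2/3}`. [folklore] -/
theorem norm_integral_vert_le {x C y h : ℝ} (hC : 0 ≤ C) (hy : 0 ≤ y) (hyh : y ≤ h)
    (hmeas : IntervalIntegrable (fun s : ℝ ↦ D.phiKernel (x + s * I)) volume y h)
    (hB : ∀ s ∈ Ioc y h, ‖D.phiKernel (x + s * I)‖ ≤ C * s ^ (-(1 / 3 : ℝ))) :
    ‖∫ s in y..h, D.phiKernel (x + s * I)‖ ≤ 3 / 2 * C * h ^ (2 / 3 : ℝ) := by
  have _ := hmeas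
  have hg : IntervalIntegrable (fun s : ℝ ↦ C * s ^ (-(1 / 3 : ℝ))) volume y h :=
    (intervalIntegral.intervalIntegrable_rpow' (by norm_num)).const_mul C
  calc ‖∫ s in y..h, D.phiKernel (x + s * I)‖ ≤ ∫ s in y..h, C * s ^ (-(1 / 3 : ℝ)) :=
        intervalIntegral.norm_integral_le_of_norm_le hyh (ae_of_all _ fun s hs ↦ hB s hs) hg
    _ = C * ((h ^ (2 / 3 : ℝ) - y ^ (2 / 3 : ℝ)) / (2 / 3)) := by
        rw [intervalIntegral.integral_const_mul, integral_rpow (Or.inl (by norm_num))]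
        norm_num
    _ ≤ C * (h ^ (2 / 3 : ℝ) / (2 / 3)) := by
        gcongr
        linarith [Real.rpow_nonneg hy (2 / 3 : ℝ)]
    _ = 3 / 2 * C * h ^ (2 / 3 : ℝ) := by ring

/-- Integrability of the kernel on a vertical segment `[0, r]` above a vertex `p` under the
vertex bound. [folklore] -/
theorem intervalIntegrable_vertex {p r C : ℝ} (hr : 0 < r)
    (hB : ∀ w : ℂ, 0 < w.im → ‖w - p‖ ≤ r → ‖D.phiKernel w‖ ≤ C * ‖w - p‖ ^ (-(1 / 3 : ℝ))) :
    IntervalIntegrable (fun s : ℝ ↦ D.phiKernel (p + s * I)) volume 0 r := by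
  have hg : IntervalIntegrable (fun s : ℝ ↦ C * s ^ (-(1 / 3 : ℝ))) volume 0 r :=
    (intervalIntegral.intervalIntegrable_rpow' (by norm_num)).const_mul C
  refine hg.mono_fun' ?_ ?_
  · rw [uIoc_of_le hr.le]
    exact ((D.continuousOn_phiKernel_vert_Ioi p).mono Ioc_subset_Ioi_self).aestronglyMeasurable measurableSet_Ioc
  · rw [uIoc_of_le hr.le]
    refine (ae_restrict_iff' measurableSet_Ioc).2 (ae_of_all _ fun s hs ↦ ?_)
    have hnorm : ‖((p : ℂ) + s * I) - p‖ = s := by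
      rw [add_sub_cancel_left, norm_mul, Complex.norm_I, mul_one, Complex.norm_real, Real.norm_eq_abs, abs_of_pos hs.1]
    have := hB ((p : ℂ) + s * I) (by simpa using hs.1) (by rw [hnorm]; exact hs.2)
    rwa [hnorm] at this

/-- **The vertex value** `V_p = Φ(p + ir) − i ∫₀^r Φ'(p + is) ds` (the limit of `Φ` at the real
point `p` along the vertical). [folklore] -/
def vertexVal (p r : ℝ) : ℂ := D.phi (p + r * I) - I * ∫ s in (0:ℝ)..r, D.phiKernel (p + s * I)

/-- Auxiliary statement (`phi_sub_vertexVal`). [folklore] -/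
theorem phi_sub_vertexVal {p r C : ℝ} (hr : 0 < r)
    (hB : ∀ w : ℂ, 0 < w.im → ‖w - p‖ ≤ r → ‖D.phiKernel w‖ ≤ C * ‖w - p‖ ^ (-(1 / 3 : ℝ)))
    {h : ℝ} (hh : 0 < h) (hhr : h ≤ r) :
    D.phi (p + h * I) - D.vertexVal p r = I * ∫ s in (0:ℝ)..h, D.phiKernel (p + s * I) := by
  have hv := D.phi_vert p hh hr
  have hint := D.intervalIntegrable_vertex hr hB
  have hadd := intervalIntegral.integral_add_adjacent_intervals (hint.mono_set (by
      rw [uIcc_of_le hh.le, uIcc_of_le hr.le]; exact Icc_subset_Icc le_rfl hhr))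
    (D.intervalIntegrable_phiKernel_vert p hh hr)
  unfold vertexVal
  linear_combination -hv - I * hadd

/-- **Three-leg estimate at a vertex**: under the vertex bound `‖Φ'(w)‖ ≤ C‖w−p‖^{-1/3}` on
`ℍ ∩ B̄(p, r)`, `‖Φ(w) − V_p‖ ≤ 7C‖w − p‖^{2/3}` for `w ∈ ℍ`, `‖w − p‖ ≤ r/3`. [folklore] -/
theorem norm_phi_sub_vertexVal_le {p r C : ℝ} (hr : 0 < r) (hC : 0 ≤ C)
    (hB : ∀ w : ℂ, 0 < w.im → ‖w - p‖ ≤ r → ‖D.phiKernel w‖ ≤ C * ‖w - p‖ ^ (-(1 / 3 : ℝ)))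
    {w : ℂ} (hw : 0 < w.im) (hwp : ‖w - p‖ ≤ r / 3) :
    ‖D.phi w - D.vertexVal p r‖ ≤ 7 * C * ‖w - p‖ ^ (2 / 3 : ℝ) := by
  set d := ‖w - p‖ with hd
  have hd0 : 0 < d := by
    rw [hd, norm_pos_iff]; intro h0
    have : (w - (p : ℂ)).im = 0 := by rw [h0]; rfl
    simp at this; linarith
  set x := w.re with hx
  set y := w.im with hy
  set h := 2 * d with hh
  have hh0 : 0 < h := by positivity
  have hhr : h ≤ r := by linarith
  have hwxy : w = (x : ℂ) + y * I := by rw [hx, hy, re_add_im]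
  have hyd : y ≤ d := by
    have := abs_im_le_norm (w - p); simp only [sub_im, ofReal_im, sub_zero] at this
    rwa [abs_of_pos hw] at this
  have hxd : |x - p| ≤ d := by
    have := abs_re_le_norm (w - p); simp only [sub_re, ofReal_re] at this; exact this
  have hyh : y ≤ h := by linarith
  -- bound along the vertical leg above `w`
  have hBv : ∀ s ∈ Ioc y h, ‖D.phiKernel (x + s * I)‖ ≤ C * s ^ (-(1 / 3 : ℝ)) := by
    intro s hs
    have hs0 : 0 < s := hw.trans_le (le_of_lt hs.1)
    have hq : ‖((x : ℂ) + s * I) - p‖ ≤ r := by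
      calc ‖((x : ℂ) + s * I) - p‖ = ‖((x - p : ℝ) : ℂ) + s * I‖ := by push_cast; ring_nf
        _ ≤ ‖((x - p : ℝ) : ℂ)‖ + ‖(s : ℂ) * I‖ := norm_add_le _ _
        _ = |x - p| + s := by
            rw [Complex.norm_real, Real.norm_eq_abs, norm_mul, Complex.norm_I, mul_one, Complex.norm_real,
              Real.norm_eq_abs, abs_of_pos hs0]
        _ ≤ r := by linarith [hs.2]
    have hge : s ≤ ‖((x : ℂ) + s * I) - p‖ := by
      have := le_norm_ofReal_add_mul_I (x - p) hs0.le
      calc s ≤ ‖((x - p : ℝ) : ℂ) + s * I‖ := this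
        _ = ‖((x : ℂ) + s * I) - p‖ := by push_cast; ring_nf
    calc ‖D.phiKernel (x + s * I)‖ ≤ C * ‖((x : ℂ) + s * I) - p‖ ^ (-(1 / 3 : ℝ)) :=
          hB _ (by simpa using hs0) hq
      _ ≤ C * s ^ (-(1 / 3 : ℝ)) :=
          mul_le_mul_of_nonneg_left (Real.rpow_le_rpow_of_nonpos hs0 hge (by norm_num)) hC
  -- bound along the horizontal leg at height `h`
  have hBh : ∀ t ∈ Ι p x, ‖D.phiKernel (t + h * I)‖ ≤ C * h ^ (-(1 / 3 : ℝ)) := by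
    intro t ht
    have htp : |t - p| ≤ |x - p| := by
      rcases le_total p x with hpx | hpx
      · rw [uIoc_of_le hpx] at ht
        rw [abs_of_nonneg (by linarith [ht.1]), abs_of_nonneg (by linarith)]; linarith [ht.2]
      · rw [uIoc_of_ge hpx] at ht
        rw [abs_of_nonpos (by linarith [ht.2]), abs_of_nonpos (by linarith)]; linarith [ht.1]
    have hq : ‖((t : ℂ) + h * I) - p‖ ≤ r := by
      calc ‖((t : ℂ) + h * I) - p‖ = ‖((t - p : ℝ) : ℂ) + h * I‖ := by push_cast; ring_nf
        _ ≤ ‖((t - p : ℝ) : ℂ)‖ + ‖(h : ℂ) * I‖ := norm_add_le _ _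
        _ = |t - p| + h := by
            rw [Complex.norm_real, Real.norm_eq_abs, norm_mul, Complex.norm_I, mul_one, Complex.norm_real,
              Real.norm_eq_abs, abs_of_pos hh0]
        _ ≤ r := by linarith
    have hge : h ≤ ‖((t : ℂ) + h * I) - p‖ := by
      have := le_norm_ofReal_add_mul_I (t - p) hh0.le
      calc h ≤ ‖((t - p : ℝ) : ℂ) + h * I‖ := this
        _ = ‖((t : ℂ) + h * I) - p‖ := by push_cast; ring_nf
    calc ‖D.phiKernel (t + h * I)‖ ≤ C * ‖((t : ℂ) + h * I) - p‖ ^ (-(1 / 3 : ℝ)) :=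
          hB _ (by simpa using hh0) hq
      _ ≤ C * h ^ (-(1 / 3 : ℝ)) :=
          mul_le_mul_of_nonneg_left (Real.rpow_le_rpow_of_nonpos hh0 hge (by norm_num)) hC
  -- the three legs
  have leg1 := D.phi_vert x hw hh0
  have leg2 := D.phi_horiz p x hh0
  have leg3 := D.phi_sub_vertexVal hr hB hh0 hhr
  have e1 : ‖D.phi (x + h * I) - D.phi (x + y * I)‖ ≤ 3 / 2 * C * h ^ (2 / 3 : ℝ) := by
    rw [leg1, norm_mul, Complex.norm_I, one_mul]
    exact D.norm_integral_vert_le hC hw.le hyh (D.intervalIntegrable_phiKernel_vert x hw hh0) hBv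
  have e2 : ‖D.phi (x + h * I) - D.phi (p + h * I)‖ ≤ 1 / 2 * C * h ^ (2 / 3 : ℝ) := by
    rw [leg2]
    refine (intervalIntegral.norm_integral_le_of_norm_le_const hBh).trans ?_
    have hxd' : |x - p| ≤ h / 2 := by linarith
    calc C * h ^ (-(1 / 3 : ℝ)) * |x - p| ≤ C * h ^ (-(1 / 3 : ℝ)) * (h / 2) :=
          mul_le_mul_of_nonneg_left hxd' (mul_nonneg hC (Real.rpow_nonneg hh0.le _))
      _ = 1 / 2 * C * (h ^ (-(1 / 3 : ℝ)) * h) := by ring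
      _ = 1 / 2 * C * h ^ (2 / 3 : ℝ) := by
          rw [← Real.rpow_add_one hh0.ne']; norm_num
  have e3 : ‖D.phi (p + h * I) - D.vertexVal p r‖ ≤ 3 / 2 * C * h ^ (2 / 3 : ℝ) := by
    rw [leg3, norm_mul, Complex.norm_I, one_mul]
    refine D.norm_integral_vert_le hC le_rfl hh0.le ((D.intervalIntegrable_vertex hr hB).mono_set ?_) ?_
    · rw [uIcc_of_le hh0.le, uIcc_of_le hr.le]; exact Icc_subset_Icc le_rfl hhr
    · intro s hs
      have hnorm : ‖((p : ℂ) + s * I) - p‖ = s := by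
        rw [add_sub_cancel_left, norm_mul, Complex.norm_I, mul_one, Complex.norm_real, Real.norm_eq_abs,
          abs_of_pos hs.1]
      have := hB ((p : ℂ) + s * I) (by simpa using hs.1) (by rw [hnorm]; linarith [hs.2])
      rwa [hnorm] at this
  have hdecomp : D.phi w - D.vertexVal p r = -(D.phi (x + h * I) - D.phi (x + y * I))
      + (D.phi (x + h * I) - D.phi (p + h * I)) + (D.phi (p + h * I) - D.vertexVal p r) := by
    rw [hwxy]; ring
  rw [hdecomp]
  have hh23 : h ^ (2 / 3 : ℝ) ≤ 2 * d ^ (2 / 3 : ℝ) := by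
    rw [hh, Real.mul_rpow (by norm_num) hd0.le]
    gcongr
    exact two_rpow_two_thirds_le
  calc _ ≤ ‖-(D.phi (x + h * I) - D.phi (x + y * I))‖ + ‖D.phi (x + h * I) - D.phi (p + h * I)‖
        + ‖D.phi (p + h * I) - D.vertexVal p r‖ := norm_add₃_le
    _ ≤ 3 / 2 * C * h ^ (2 / 3 : ℝ) + 1 / 2 * C * h ^ (2 / 3 : ℝ) + 3 / 2 * C * h ^ (2 / 3 : ℝ) := by
        rw [norm_neg]; gcongr
    _ = 7 / 2 * C * h ^ (2 / 3 : ℝ) := by ring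
    _ ≤ 7 / 2 * C * (2 * d ^ (2 / 3 : ℝ)) := by gcongr
    _ = 7 * C * d ^ (2 / 3 : ℝ) := by ring

/-! ### The vertex bounds at `0` and `1` -/

/-- Radius of a closed disc around `0` free of the support intervals. [folklore] -/
def rz : ℝ := min D.α D.γ / 2

/-- Auxiliary statement (`rz_pos`). [folklore] -/
theorem rz_pos : 0 < D.rz := by unfold rz; exact half_pos (lt_min D.hα D.hγ)

/-- Auxiliary statement (`rz_le_half`). [folklore] -/
theorem rz_le_half : D.rz ≤ 1 / 2 := by
  unfold rz; linarith [min_le_left D.α D.γ, D.hαβ, D.hβ]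

/-- Auxiliary statement (`closedBall_zero_subset_gDomain`). [folklore] -/
theorem closedBall_zero_subset_gDomain : closedBall (0:ℂ) D.rz ⊆ D.gDomain := by
  intro w hw
  rw [mem_closedBall, dist_zero_right] at hw
  have hre : w.re < min D.α D.γ := by
    have := (abs_re_le_norm w).trans hw
    have h2 : D.rz < min D.α D.γ := by unfold rz; linarith [lt_min D.hα D.hγ]
    exact lt_of_le_of_lt (le_abs_self _) (this.trans_lt h2)
  exact ⟨Or.inr (Or.inl (hre.trans_le (min_le_left _ _))), Or.inr (Or.inl (hre.trans_le (min_le_right _ _)))⟩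

/-- Radius of a closed disc around `1` free of the support intervals. [folklore] -/
def ro : ℝ := (1 - max D.β D.δ) / 2

/-- Auxiliary statement (`ro_pos`). [folklore] -/
theorem ro_pos : 0 < D.ro := by unfold ro; linarith [max_lt D.hβ D.hδ]

/-- Auxiliary statement (`ro_le_half`). [folklore] -/
theorem ro_le_half : D.ro ≤ 1 / 2 := by
  unfold ro; linarith [le_max_left D.β D.δ, D.hα, D.hαβ]

/-- Auxiliary statement (`closedBall_one_subset_gDomain`). [folklore] -/
theorem closedBall_one_subset_gDomain : closedBall (1:ℂ) D.ro ⊆ D.gDomain := by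
  intro w hw
  rw [mem_closedBall, dist_eq_norm] at hw
  have hre : max D.β D.δ < w.re := by
    have h1 := (abs_re_le_norm (w - 1)).trans hw
    simp only [sub_re, one_re] at h1
    have h2 : D.ro < 1 - max D.β D.δ := by unfold ro; linarith [max_lt D.hβ D.hδ]
    have := neg_abs_le (w.re - 1)
    linarith
  exact ⟨Or.inr (Or.inr ((le_max_left _ _).trans_lt hre)), Or.inr (Or.inr ((le_max_right _ _).trans_lt hre))⟩

/-- **Vertex bound at `0`**: `‖Φ'(w)‖ ≤ C₀ ‖w‖^{-1/3}` on `ℍ ∩ B̄(0, rz)`. [folklore] -/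
theorem exists_vertexBound_zero : ∃ C, 0 ≤ C ∧
    ∀ w : ℂ, 0 < w.im → ‖w - ((0:ℝ) : ℂ)‖ ≤ D.rz → ‖D.phiKernel w‖ ≤ C * ‖w - ((0:ℝ) : ℂ)‖ ^ (-(1 / 3 : ℝ)) := by
  obtain ⟨G, hG⟩ := (isCompact_closedBall (0:ℂ) D.rz).exists_bound_of_continuousOn
    (D.continuousOn_g.mono D.closedBall_zero_subset_gDomain)
  refine ⟨2 * max G 0, by positivity, fun w hw hwr ↦ ?_⟩
  simp only [ofReal_zero, sub_zero] at hwr ⊢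
  have hw0 : w ≠ 0 := by rintro rfl; simp at hw
  have hw1 : w ≠ 1 := by rintro rfl; simp at hw
  have hrz := D.rz_le_half
  have h1w : 1 / 2 ≤ ‖1 - w‖ := by
    have := norm_sub_norm_le 1 w; rw [norm_one] at this; linarith
  rw [D.norm_phiKernel hw0 hw1]
  have hg : ‖D.g w‖ ≤ max G 0 := (hG w (by rw [mem_closedBall, dist_zero_right]; exact hwr)).trans (le_max_left _ _)
  have hQ := rpow_neg_third_le_two h1w
  have hP : 0 ≤ ‖w‖ ^ (-(1 / 3 : ℝ)) := Real.rpow_nonneg (norm_nonneg _) _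
  calc ‖w‖ ^ (-(1 / 3 : ℝ)) * ‖1 - w‖ ^ (-(1 / 3 : ℝ)) * ‖D.g w‖ ≤ ‖w‖ ^ (-(1 / 3 : ℝ)) * 2 * max G 0 := by
        rw [mul_assoc, mul_assoc]
        exact mul_le_mul_of_nonneg_left (mul_le_mul hQ hg (norm_nonneg _) (by norm_num)) hP
    _ = 2 * max G 0 * ‖w‖ ^ (-(1 / 3 : ℝ)) := by ring

/-- **Vertex bound at `1`**: `‖Φ'(w)‖ ≤ C₁ ‖w − 1‖^{-1/3}` on `ℍ ∩ B̄(1, ro)`. [folklore] -/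
theorem exists_vertexBound_one : ∃ C, 0 ≤ C ∧
    ∀ w : ℂ, 0 < w.im → ‖w - ((1:ℝ) : ℂ)‖ ≤ D.ro → ‖D.phiKernel w‖ ≤ C * ‖w - ((1:ℝ) : ℂ)‖ ^ (-(1 / 3 : ℝ)) := by
  obtain ⟨G, hG⟩ := (isCompact_closedBall (1:ℂ) D.ro).exists_bound_of_continuousOn
    (D.continuousOn_g.mono D.closedBall_one_subset_gDomain)
  refine ⟨2 * max G 0, by positivity, fun w hw hwr ↦ ?_⟩
  simp only [ofReal_one] at hwr ⊢
  have hw0 : w ≠ 0 := by rintro rfl; simp at hw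
  have hw1 : w ≠ 1 := by rintro rfl; simp at hw
  have hro := D.ro_le_half
  have h0w : 1 / 2 ≤ ‖w‖ := by
    have := norm_sub_norm_le 1 w; rw [norm_one, norm_sub_rev] at this; linarith
  rw [norm_sub_rev w 1, D.norm_phiKernel hw0 hw1]
  have hg : ‖D.g w‖ ≤ max G 0 := (hG w (by rw [mem_closedBall, dist_eq_norm]; exact hwr)).trans (le_max_left _ _)
  have hP := rpow_neg_third_le_two h0w
  have hQ : 0 ≤ ‖1 - w‖ ^ (-(1 / 3 : ℝ)) := Real.rpow_nonneg (norm_nonneg _) _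
  calc ‖w‖ ^ (-(1 / 3 : ℝ)) * ‖1 - w‖ ^ (-(1 / 3 : ℝ)) * ‖D.g w‖ ≤ 2 * ‖1 - w‖ ^ (-(1 / 3 : ℝ)) * max G 0 := by
        gcongr
    _ = 2 * max G 0 * ‖1 - w‖ ^ (-(1 / 3 : ℝ)) := by ring

/-! ### Local holomorphic extension across regular real points -/

/-- **Local primitive across a regular boundary point**: if `p ∈ ℝ` lies in the holomorphy domain
of `Φ'`, there is a disc around `p` and a holomorphic `Ψ` on it with `Ψ' = Φ'` and `Ψ = Φ` on the
upper half of the disc. [folklore] -/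
theorem exists_primitive_near {p : ℝ} (hp : (p : ℂ) ∈ D.kernelDomain) :
    ∃ ε > 0, ∃ Ψ : ℂ → ℂ, (∀ z ∈ ball (p : ℂ) ε, HasDerivAt Ψ (D.phiKernel z) z) ∧
      ∀ z ∈ ball (p : ℂ) ε, 0 < z.im → D.phi z = Ψ z := by
  obtain ⟨ε, hε, hball⟩ := Metric.isOpen_iff.1 D.isOpen_kernelDomain p hp
  have hdiff : DifferentiableOn ℂ D.phiKernel (ball (p : ℂ) ε) := D.differentiableOn_phiKernel.mono hball
  obtain ⟨Ψ₀, hΨ₀⟩ := hdiff.isExactOn_ball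
  -- on the upper half-disc both `Φ` and `Ψ₀` are primitives of `Φ'`
  set U : Set ℂ := ball (p : ℂ) ε ∩ upperHalfPlaneSet with hU
  have hUopen : IsOpen U := isOpen_ball.inter isOpen_upperHalfPlaneSet
  have hUconn : IsPreconnected U := ((convex_ball _ _).inter (convex_halfSpace_im_gt 0)).isPreconnected
  have hΦU : DifferentiableOn ℂ D.phi U := D.differentiableOn_phi.mono inter_subset_right
  have hΨU : DifferentiableOn ℂ Ψ₀ U := fun z hz ↦ (hΨ₀ z hz.1).differentiableAt.differentiableWithinAt
  have hderiv : U.EqOn (deriv D.phi) (deriv Ψ₀) := by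
    intro z hz
    rw [(D.hasDerivAt_phi hz.2).deriv, (hΨ₀ z hz.1).deriv]
  obtain ⟨a, ha⟩ := hUopen.exists_eq_add_of_deriv_eq hUconn hΦU hΨU hderiv
  refine ⟨ε, hε, fun z ↦ Ψ₀ z + a, fun z hz ↦ (hΨ₀ z hz).add_const a, fun z hz hzim ↦ ?_⟩
  exact ha ⟨hz, hzim⟩

end TestIntervals

end Literature.Probability.RandomPlanarGeometry
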